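import Summits.QuantumFields.QCD.Theses.AnomalyRigidity
import Summits.QuantumFields.QCD.Theorems.HeatSlicedQuarksRobustYangMillsHandoverStubTreeDecayBoundsGermMoments

/-!
# Stub `stub_farMomentsBoundGerm` of line `lee-yang-mass-handover` (gen 5)
(crux `Summit.QuantumFields.QCD.Theses.HeatSlicedQuarks.RobustYangMillsHandover`,
item stmt-QuantumFields-8892; closes item stmt-QuantumFields-17719
`Summit.QuantumFields.QCD.Theses.AnomalyRigidity.FarMomentsBoundGerm` of route AnomalyRigidity, rev 6)

**Local + far-region weighted moments ⇒ m-uniformly bounded mixed germ.**  Item 17719 replaces the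
(proved) pointwise item 16261 `TreeDecayBoundsGerm` on the deciding path of route `AnomalyRigidity`: the
far-region input is now the L¹ bound of item 17718 `UniformGapFarMoments` instead of pointwise tree decay.

Proof (pure real analysis on top of the landed engine
`treeGerm_germ_bound_of_moments`, file `…StubTreeDecayBoundsGermMoments.lean`): with `Rl := max R₀ 1`, every
pair `(x, y)` of the box is either NEAR (`‖ξ‖, ‖η‖ ≤ Rl`) or FAR (`R₀ ≤ Rl < max ‖ξ‖ ‖η‖`); the summands
`a⁸ ‖ξ‖^i ‖η‖^j ‖w G‖` are non-negative, so the global `(i, j)`-moment is at most the near-indicator sum plus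
the far-indicator sum, eventually `≤ C_near + C_far` on every torus `S ≥ L_k` (both hypotheses are eventual in
`k` and uniform in `S ≥ L_k`, `Filter.Eventually.and`); then `treeGerm_germ_bound_of_moments` with
`Mb := C_near + C_far` gives the bounded bilinear germ, `K := C_near + C_far` uniformly in `m, μ, ν`.
(Same proof as the grounder g71-3 candidate `Cand17719.lean` of 2026-08-16T23:50Z, re-derived here; the
evidence path is not mounted in the prover jail.)
-/

namespace Summit.QuantumFields.QCD.Cruxes.RobustYangMillsHandover.LeeYangMassHandover

open Filter Topology Asymptotics Finset Literature.Probability.LatticeModels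
open Summit.QuantumFields.QCD.Theses.AnomalyRigidity
open Literature.MathematicalPhysics.QuantumFieldTheory

/-! ## The analytic statement behind item 17719 -/

/-- **Local + far-region moments ⇒ bounded mixed germ, m-uniformly** (the analytic content of item 17719,
for abstract lattice data `w_k G_m^{μν}(k,S;x,y)` on the scaled lattices `a_k ℤ⁴`): the near box of radius
`max R₀ 1` and the far region `{R₀ ≤ max ‖ξ‖ ‖η‖}` cover `box²`, so the global weighted moments are eventually
`≤ C_near + C_far`; then `treeGerm_germ_bound_of_moments`. [folklore] -/
theorem farMoments_main (a : ℕ → ℝ) (L : ℕ → ℕ)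
    (w : ℕ → ℂ) (G : ℝ → Fin 4 → Fin 4 → ℕ → ℕ → (Fin 4 → ℤ) → (Fin 4 → ℤ) → ℂ)
    (ΓP : ℝ → (Fin 4 → ℝ) → (Fin 4 → ℝ) → Fin 4 → Fin 4 → ℂ) (m₁ : ℝ) (hm₁1 : m₁ ≤ 1)
    (hconv : ∀ m : ℝ, 0 < m → m ≤ m₁ → ∀ (p q : Fin 4 → ℝ) (μ ν : Fin 4) (δ : ℝ), 0 < δ →
      ∀ᶠ k in atTop, ∀ S : ℕ, L k ≤ S →
        ‖((a k ^ 8 : ℝ) : ℂ) * ∑ x ∈ box 4 S, ∑ y ∈ box 4 S,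
            Complex.exp (Complex.I *
              ((∑ i, (p i * (a k * (x i : ℝ)) + q i * (a k * (y i : ℝ))) : ℝ) : ℂ)) *
              w k * G m μ ν k S x y - ΓP m p q μ ν‖ ≤ δ)
    (hmom : ∀ Rl : ℝ, 0 < Rl → ∃ C : ℝ, ∀ m : ℝ, 0 < m → m ≤ 1 → ∀ i j : ℕ, 1 ≤ i → i ≤ 2 → 1 ≤ j →
      j ≤ 2 → ∀ μ ν : Fin 4, ∀ᶠ k in atTop, ∀ S : ℕ, L k ≤ S →
        (∑ x ∈ box 4 S, ∑ y ∈ box 4 S,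
          if ‖(fun i => a k * (x i : ℝ))‖ ≤ Rl ∧ ‖(fun i => a k * (y i : ℝ))‖ ≤ Rl then
            a k ^ 8 * ‖(fun i => a k * (x i : ℝ))‖ ^ i * ‖(fun i => a k * (y i : ℝ))‖ ^ j *
              ‖w k * G m μ ν k S x y‖
          else 0) ≤ C)
    (hfar : ∃ R₀ C : ℝ, ∀ m : ℝ, 0 < m → m ≤ m₁ → ∀ i j : ℕ, 1 ≤ i → i ≤ 2 → 1 ≤ j → j ≤ 2 →
      ∀ μ ν : Fin 4, ∀ᶠ k in atTop, ∀ S : ℕ, L k ≤ S →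
        (∑ x ∈ box 4 S, ∑ y ∈ box 4 S,
          if R₀ ≤ max ‖(fun i => a k * (x i : ℝ))‖ ‖(fun i => a k * (y i : ℝ))‖ then
            a k ^ 8 * ‖(fun i => a k * (x i : ℝ))‖ ^ i * ‖(fun i => a k * (y i : ℝ))‖ ^ j *
              ‖w k * G m μ ν k S x y‖
          else 0) ≤ C) :
    ∃ K : ℝ, ∀ m : ℝ, 0 < m → m ≤ m₁ → ∀ μ ν : Fin 4, ∃ B : Fin 4 → Fin 4 → ℂ,
      (∀ al be, ‖B al be‖ ≤ K) ∧
        (fun k : (Fin 4 → ℝ) × (Fin 4 → ℝ) =>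
            ΓP m k.1 k.2 μ ν - ΓP m k.1 0 μ ν - ΓP m 0 k.2 μ ν + ΓP m 0 0 μ ν -
              ∑ al : Fin 4, ∑ be : Fin 4, B al be * ((k.1 al : ℝ) : ℂ) * ((k.2 be : ℝ) : ℂ)) =o[𝓝 0]
          (fun k : (Fin 4 → ℝ) × (Fin 4 → ℝ) => ‖k‖ ^ 2) := by
  obtain ⟨R₀, Cf, hCf⟩ := hfar
  set Rl : ℝ := max R₀ 1 with hRl
  have hRl0 : 0 < Rl := lt_of_lt_of_le one_pos (le_max_right _ _)
  have hR₀ : R₀ ≤ Rl := le_max_left _ _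
  obtain ⟨Cl, hCl⟩ := hmom Rl hRl0
  refine ⟨Cl + Cf, fun m hm hm1 μ ν => ?_⟩
  refine treeGerm_germ_bound_of_moments a L (fun k x i => a k * (x i : ℝ)) w
    (fun k S x y => G m μ ν k S x y) (fun p q => ΓP m p q μ ν) (Cl + Cf) ?_ ?_
  · intro p q δ hδ
    exact hconv m hm hm1 p q μ ν δ hδ
  · intro i j hi1 hi2 hj1 hj2
    filter_upwards [hCl m hm (hm1.trans hm₁1) i j hi1 hi2 hj1 hj2 μ ν,
      hCf m hm hm1 i j hi1 hi2 hj1 hj2 μ ν] with k hloc hfr S hS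
    have hloc := hloc S hS
    have hfr := hfr S hS
    -- the scaled lattice at step `k`
    set φ : (Fin 4 → ℤ) → (Fin 4 → ℝ) := fun x i => a k * (x i : ℝ) with hφ
    have hφx : ∀ x : Fin 4 → ℤ, (fun i => a k * (x i : ℝ)) = φ x := fun x => rfl
    simp only [hφx] at hloc hfr ⊢
    -- the summand and its near/far split
    set f : (Fin 4 → ℤ) → (Fin 4 → ℤ) → ℝ := fun x y =>
      a k ^ 8 * ‖φ x‖ ^ i * ‖φ y‖ ^ j * ‖w k * G m μ ν k S x y‖ with hf
    have hf0 : ∀ x y, 0 ≤ f x y := fun x y => by positivity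
    have hcover : ∀ x y, ¬ (‖φ x‖ ≤ Rl ∧ ‖φ y‖ ≤ Rl) → R₀ ≤ max ‖φ x‖ ‖φ y‖ := by
      intro x y hnot
      rcases not_and_or.mp hnot with h | h
      · exact hR₀.trans ((not_le.mp h).le.trans (le_max_left _ _))
      · exact hR₀.trans ((not_le.mp h).le.trans (le_max_right _ _))
    have hsplit : ∀ x y, f x y ≤ (if ‖φ x‖ ≤ Rl ∧ ‖φ y‖ ≤ Rl then f x y else 0) +
        (if R₀ ≤ max ‖φ x‖ ‖φ y‖ then f x y else 0) := by
      intro x y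
      by_cases h : ‖φ x‖ ≤ Rl ∧ ‖φ y‖ ≤ Rl
      · rw [if_pos h]
        have : 0 ≤ (if R₀ ≤ max ‖φ x‖ ‖φ y‖ then f x y else 0) := by
          split_ifs
          · exact hf0 x y
          · exact le_rfl
        linarith
      · rw [if_neg h, if_pos (hcover x y h)]
        linarith
    calc ∑ x ∈ box 4 S, ∑ y ∈ box 4 S, a k ^ 8 * ‖φ x‖ ^ i * ‖φ y‖ ^ j * ‖w k * G m μ ν k S x y‖
        = ∑ x ∈ box 4 S, ∑ y ∈ box 4 S, f x y := rfl
      _ ≤ ∑ x ∈ box 4 S, ∑ y ∈ box 4 S, ((if ‖φ x‖ ≤ Rl ∧ ‖φ y‖ ≤ Rl then f x y else 0) +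
            (if R₀ ≤ max ‖φ x‖ ‖φ y‖ then f x y else 0)) :=
          Finset.sum_le_sum fun x _ => Finset.sum_le_sum fun y _ => hsplit x y
      _ = (∑ x ∈ box 4 S, ∑ y ∈ box 4 S, if ‖φ x‖ ≤ Rl ∧ ‖φ y‖ ≤ Rl then f x y else 0) +
            ∑ x ∈ box 4 S, ∑ y ∈ box 4 S, (if R₀ ≤ max ‖φ x‖ ‖φ y‖ then f x y else 0) := by
          rw [← Finset.sum_add_distrib]
          exact Finset.sum_congr rfl fun x _ => Finset.sum_add_distrib
      _ ≤ Cl + Cf := add_le_add hloc hfr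

/-! ## The item -/

/-- **Item stmt-QuantumFields-17719 `AnomalyRigidity.FarMomentsBoundGerm`**: if the torus transforms of
`u³⟨V_μ(x)V_ν(y)P(0)⟩` converge to `Γ^P_m` (`m ∈ (0, m₁]`) for all tori `S ≥ L_k` eventually in `k`, the
m-uniform LOCAL weighted-moment bounds hold at every radius and the FAR-REGION weighted moments beyond some `R₀`
are m-uniformly bounded, then the mixed second difference of `Γ^P_m` at zero momentum is a bilinear form `B`
up to `o(‖(p,q)‖²)`, with `|B_{αβ}| ≤ K` uniformly in `m, μ, ν` (`K = C_near + C_far`).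
[cite: GlimmJaffe1987, §6.1] -/
theorem stub_farMomentsBoundGerm : FarMomentsBoundGerm := by
  intro Nf reg V P uV uP ΓP m₁
  dsimp only
  intro hm₁ hm₁1 hconv hmom hfar
  exact farMoments_main reg.a reg.L (fun k => ((uV k * uV k * uP k : ℝ) : ℂ))
    (fun m μ ν k S x y => qcdTorusExpect (reg.β k) (2 * S + 1)
      (fun fl => (reg.scheme (fun _ : Fin Nf => m) 0 0).mq fl k)
      (fun U => (V μ).onTorus (2 * S + 1) x U * (V ν).onTorus (2 * S + 1) y U * P.onTorus (2 * S + 1) 0 U))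
    ΓP m₁ hm₁1 hconv hmom hfar

end Summit.QuantumFields.QCD.Cruxes.RobustYangMillsHandover.LeeYangMassHandover
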